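import Literature.AnabelianGeometry.EtaleTheta.SettingModelTateZNAllSplittings
import Literature.AnabelianGeometry.EtaleTheta.SettingModelHasThetaTopology
import Literature.AnabelianGeometry.EtaleTheta.SettingModelKrullCuspLaws
import Literature.AnabelianGeometry.EtaleTheta.SettingModelKrullCuspThm16Origin
import Literature.AnabelianGeometry.EtaleTheta.SettingModelKrullNotTateOrigin
import Literature.AnabelianGeometry.EtaleTheta.Discharge.Sec1ZNSplittingOfCuspSection
import HarnessLib

/-!
# [EtTh] Thm. 1.6 (iii) at the origin predicates: KERNEL CENSUS of the setting-level covering inputs —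
# what IS jointly witnessed at the tree's models, and what is not (proof-only)

Mochizuki, *The étale theta function and its Frobenioid-theoretic manifestations*, Publ. RIMS **45** (2009) [EtTh],
§1 pp. 12–14 (the setting, `Y_N`, `Z_N`), Thm. 1.6 p. 24 [cite: MochizukiEtTh2009, Thm 1.6 (iii) p.25].

abc-iut cell, layer L2, seat abc-iut-L2-t1 (§1 ROOT owner, gen 7; row 3, abc-iut-L2-lead R593: «the JOINT-ORIGIN residual
census note as a kernel NV statement of what IS jointly witnessed mod hsc vs what is not»). PROOF-ONLY (no definition,
no `Prop`-valued definition, no new named fact): every conjunct below is a LANDED theorem consumed BY NAME.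

The K3 end-knit v5 `Thm16Sub.thm16iii_of_origins` (p462527) takes, PER SETTING, the predicates/clauses
{`IsEtThOrigin` (guard), `IsThm16Origin` (R1, R2 ∀N, cusp of `X^log` in `Π^tp_Y`, R3, TM₂), `IsTateOrigin` (TM ∀N ⇒
`GKNIsKernelOfAction` ∀N), `HasThetaTopology`, `GtpZNFromSplitting` ∀N, «lifted splittings over `G_{K_N}` exist» ∀N
(⟸ one cusp section)}, besides the pair inputs `hΔ`, `h65`, strong completeness `hsc` and the Prop. 1.5 / valuation /
inversion / cusp-evaluation inputs. THIS FILE records, as two conjunctions and one `∃ ∧ ∃` statement, where the tree's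
semi-synthetic models stand on the setting-level list:

* `modelχq_thm16iiiOriginInputs (hsc)` — the STAGE-2 model `modelχq p i 2` (abc-iut-L2-t5) carries: guard ✓ ·
  `IsTateOrigin` ✓ (abc-iut-L2-t5/w5-d051) · `HasThetaTopology` ✓ · R1 ✓ · R2 ∀N ✓ (vacuous) · `GKNIsKernelOfAction` ∀N ✓ ·
  `GtpZNFromSplitting` ∀N ✓ modulo `hsc` (this seat, p463822) · lifted splittings ∀N ✓ (abc-iut-L2-d1's standard
  splitting) — and `IsThm16Origin` ✗ by the cusp clause ALONE: NO subgroup is a cuspidal decomposition group (so no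
  cusp section either);
* `modelκ'_thm16iiiOriginInputs` — the cusped KRULL model `modelκ′` (abc-iut-L2-t10) carries: guard ✓ · `IsThm16Origin` ✓
  (abc-iut-w5-d165/L2-t10) · abc-iut-L2-t7's `CuspLaws` ✓ · R3 ✓ · a cusp SECTION package `(D_c, s)` in the exact shape
  the knit consumes (`σ ↦ (1, σ)` into `D_x = c^Ẑ ⋊ G_{ℚ_p} ≤ Π^tp_Y`) ✓ · hence lifted splittings ∀N ✓
  (`exists_thetaSplittingAt_of_cuspSection`) · `GKNIsKernelOfAction` at level `2` ✓ — and `IsTateOrigin` ✗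
  (`modelκ'_not_isTateOrigin`: the Galois action on `Γ` is trivial);
* **`thm16iii_originInputs_census (hsc)`** — both as ONE `∃ ∧ ∃` statement: the `IsTateOrigin`-side and the
  `IsThm16Origin`-side of the list are EACH jointly inhabited (next to the guard), while a joint inhabitant of
  `IsThm16Origin ∧ IsTateOrigin` is the §1-interface residual of record (abc-iut-w5-d051, abc-iut-L2-lead R550: it needs
  cusp-normalising automorphisms of the free profinite `Δ_X` with `χ(σ) ∉ {±1}` — GT-type data, none constructible in
  tree; the model-by-model negative is abc-iut-L2-t10's `no_joint_isThm16Origin_isTateOrigin_in_zoo`, restated here as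
  the third conjunct). Not recorded here (no theorem either way in tree): `GtpZNFromSplitting` at `modelκ′`,
  `HasThetaTopology` at `modelκ′`.

SEMI-SYNTHETIC MODELS = consistency / independence evidence only; nothing of [EtTh] asserted; no side taken on
[IUTchIII] Cor. 3.12; typed ≠ proved.
-/

noncomputable section

namespace Literature.AnabelianGeometry.EtaleTheta.SettingModel

open Literature.AnabelianGeometry.SemiGraphs _root_.Function _root_.Topology Thm16Sub

variable (p : ℕ) [Fact p.Prime]

/-! ### The stage-2 model: everything on the list except the cusp clause -/

/-- **The setting-level covering inputs of the K3 end-knit v5 at the STAGE-2 model `modelχq p i 2`** (granted strong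
completeness of `G_{ℚ_p}` for the `Z_N` clause): guard, `IsTateOrigin`, `HasThetaTopology`, R1, R2 ∀N, `GKNIsKernelOfAction`
∀N, `GtpZNFromSplitting` ∀N, lifted splittings ∀N — and the cusp clause FAILS (no cuspidal decomposition group at all),
hence `¬ IsThm16Origin`. [cite: MochizukiEtTh2009, §1 p.13] -/
theorem modelχq_thm16iiiOriginInputs (i : ℤ)
    (hsc : ∀ U : Subgroup (GQp p), U.FiniteIndex → IsOpen (U : Set (GQp p))) :
    (ThetaSetting.modelχq p i 2 even_two).IsEtThOrigin ∧
      (ThetaSetting.modelχq p i 2 even_two).IsTateOrigin ∧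
      (ThetaSetting.modelχq p i 2 even_two).HasThetaTopology ∧
      KerToZIsCompactlyGenerated (ThetaSetting.modelχq p i 2 even_two) ∧
      (∀ N : ℕ+, GtpYNFromCusp (ThetaSetting.modelχq p i 2 even_two) N) ∧
      (∀ N : ℕ+, GKNIsKernelOfAction (ThetaSetting.modelχq p i 2 even_two) N) ∧
      (∀ N : ℕ+, (ThetaSetting.modelχq p i 2 even_two).GtpZNFromSplitting N) ∧
      (∀ N : ℕ+, ∃ t, (ThetaSetting.modelχq p i 2 even_two).IsThetaSplittingAt N t) ∧
      (∀ Dc : Subgroup (PiTpχq p i 2), ¬ (ThetaSetting.modelχq p i 2 even_two).IsCuspidalDecompositionGroup Dc) ∧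
      ¬ (ThetaSetting.modelχq p i 2 even_two).IsThm16Origin :=
  ⟨ThetaSetting.modelχq_isEtThOrigin p i 2 even_two, modelχq_isTateOrigin p i, hasThetaTopology_modelχq p i 2 even_two,
    kerToZIsCompactlyGenerated_modelχq p i, modelχq_gtpYNFromCusp p i, modelχq_gknIsKernelOfAction p i,
    fun N => gtpZNFromSplitting_modelχq_of_stronglyComplete p i 2 even_two N hsc,
    fun N => ⟨_, isThetaSplittingAt_inr_modelχq p i 2 even_two N⟩,
    not_isCuspidalDecompositionGroup_modelχq p i, not_isThm16Origin_modelχq p i⟩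

/-! ### The cusped Krull model: everything on the list except the Tate-module clause (and the `Z_N` clause, untested) -/

/-- **The commutator-axis cusp datum of `modelκ′` in the shape the K3 knits consume**: `D_c := c^Ẑ ⋊ G_{ℚ_p}` is a cuspidal
decomposition group inside `Π^tp_Y`, and `σ ↦ (1, σ)` is a Galois section into it (abc-iut-L2-t10's `cuspDecompκ`,
`cuspidal_le_GtpY_modelκ'`; abc-iut-L2-t7's C9 `exists_continuous_section_modelκ'`). [cite: MochizukiEtTh2009, §1 p.13] -/
theorem modelκ'_cuspSection :
    (ThetaSetting.modelκ' p).IsCuspidalDecompositionGroup (cuspDecompκ p) ∧ cuspDecompκ p ≤ (ThetaSetting.modelκ' p).GtpY ∧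
      (∀ g : GQp p, g ∈ (ThetaSetting.modelκ' p).GK →
        (ThetaSetting.modelκ' p).aug ((SemidirectProduct.inr : GQp p →* PiTpκ p) g) = g) ∧
      (ThetaSetting.modelκ' p).GK.map (SemidirectProduct.inr : GQp p →* PiTpκ p) ≤ cuspDecompκ p := by
  have hDc : (ThetaSetting.modelκ' p).IsCuspidalDecompositionGroup (cuspDecompκ p) := ⟨(), trivial, 1, by rw [one_smul]⟩
  refine ⟨hDc, cuspidal_le_GtpY_modelκ' p hDc, fun g _ => rfl, ?_⟩
  rintro _ ⟨g, -, rfl⟩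
  change (SemidirectProduct.inr g : PiTpκ p) ∈ cuspDecompκ p
  rw [mem_cuspDecompκ_iff, SemidirectProduct.left_inr]
  exact Subgroup.one_mem _

/-- **The setting-level covering inputs of the K3 end-knit v5 at the cusped KRULL model `modelκ′`**: guard, `IsThm16Origin`,
`CuspLaws`, R3 (both quotient maps), a cusp SECTION package, lifted splittings over `G_{K_N}` ∀N (from the section and R2,
`exists_thetaSplittingAt_of_cuspSection`), `GKNIsKernelOfAction` at level `2` — and `IsTateOrigin` FAILS.
[cite: MochizukiEtTh2009, §1 p.13] -/
theorem modelκ'_thm16iiiOriginInputs :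
    (ThetaSetting.modelκ' p).IsEtThOrigin ∧ (ThetaSetting.modelκ' p).IsThm16Origin ∧ (ThetaSetting.modelκ' p).CuspLaws ∧
      IsQuotientMap (ThetaSetting.modelκ' p).toTheta ∧ IsQuotientMap (ThetaSetting.modelκ' p).thetaToEll ∧
      (∃ (Dc : Subgroup (ThetaSetting.modelκ' p).PiTemp) (s : GQp p →* (ThetaSetting.modelκ' p).PiTemp),
        (ThetaSetting.modelκ' p).IsCuspidalDecompositionGroup Dc ∧ Dc ≤ (ThetaSetting.modelκ' p).GtpY ∧
          (∀ g : GQp p, g ∈ (ThetaSetting.modelκ' p).GK → (ThetaSetting.modelκ' p).aug (s g) = g) ∧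
          (ThetaSetting.modelκ' p).GK.map s ≤ Dc) ∧
      (∀ N : ℕ+, ∃ t, (ThetaSetting.modelκ' p).IsThetaSplittingAt N t) ∧
      GKNIsKernelOfAction (ThetaSetting.modelκ' p) 2 ∧
      ¬ (ThetaSetting.modelκ' p).IsTateOrigin := by
  obtain ⟨hDc, hDcY, hsec, hsD⟩ := modelκ'_cuspSection p
  exact ⟨ThetaSetting.modelκ'_isEtThOrigin p, ThetaSetting.modelκ'_isThm16Origin p, cuspLaws_modelκ' p,
    isQuotientMap_toTheta_modelκ' p, isQuotientMap_thetaToEll_modelκ' p, ⟨_, _, hDc, hDcY, hsec, hsD⟩,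
    fun N => exists_thetaSplittingAt_of_cuspSection (ThetaSetting.modelκ' p) hDc hDcY _ hsec hsD N
      ((ThetaSetting.modelκ'_isThm16Origin p).gtpYN_fromCusp N),
    (ThetaSetting.modelκ'_isThm16Origin p).gknIsKernelOfAction_two, modelκ'_not_isTateOrigin p⟩

/-! ### The census as one statement -/

/-- **KERNEL CENSUS of the setting-level inputs of [EtTh] Thm. 1.6 (iii) at the origin predicates** (granted strong
completeness of `G_{ℚ_p}`, unconditional Summits-side): the `IsTateOrigin`-side of the list {guard, `IsTateOrigin`,
`HasThetaTopology`, `GtpZNFromSplitting` ∀N, lifted splittings ∀N} is JOINTLY inhabited at a setting where `IsThm16Origin`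
fails, and the `IsThm16Origin`-side {guard, `IsThm16Origin`, `CuspLaws`, cusp section, lifted splittings ∀N} is JOINTLY
inhabited at a setting where `IsTateOrigin` fails; and — abc-iut-L2-t10's zoo row
`no_joint_isThm16Origin_isTateOrigin_in_zoo` BY NAME — at each of `modelκ′`, `modelκ`, `modelχq p 0 2`, `modelχq′ p 0 2`
the conjunction `IsThm16Origin ∧ IsTateOrigin` FAILS: a joint inhabitant is the §1-interface residual of record.
[cite: MochizukiEtTh2009, Thm 1.6 (iii) p.25] -/
theorem thm16iii_originInputs_census (hsc : ∀ U : Subgroup (GQp p), U.FiniteIndex → IsOpen (U : Set (GQp p))) :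
    (∃ D : ThetaSetting p, D.IsEtThOrigin ∧ D.IsTateOrigin ∧ D.HasThetaTopology ∧
        (∀ N : ℕ+, D.GtpZNFromSplitting N) ∧ (∀ N : ℕ+, ∃ t, D.IsThetaSplittingAt N t) ∧ ¬ D.IsThm16Origin) ∧
      (∃ D : ThetaSetting p, D.IsEtThOrigin ∧ D.IsThm16Origin ∧ D.CuspLaws ∧
        (∃ (Dc : Subgroup D.PiTemp) (s : GQp p →* D.PiTemp), D.IsCuspidalDecompositionGroup Dc ∧ Dc ≤ D.GtpY ∧
          (∀ g : GQp p, g ∈ D.GK → D.aug (s g) = g) ∧ D.GK.map s ≤ Dc) ∧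
        (∀ N : ℕ+, ∃ t, D.IsThetaSplittingAt N t) ∧ ¬ D.IsTateOrigin) ∧
      (¬ ((ThetaSetting.modelκ' p).IsThm16Origin ∧ (ThetaSetting.modelκ' p).IsTateOrigin) ∧
        ¬ ((ThetaSetting.modelκ p).IsThm16Origin ∧ (ThetaSetting.modelκ p).IsTateOrigin) ∧
        ¬ ((ThetaSetting.modelχq p 0 2 even_two).IsThm16Origin ∧ (ThetaSetting.modelχq p 0 2 even_two).IsTateOrigin) ∧
        ¬ ((ThetaSetting.modelχq' p 0 2 even_two).IsThm16Origin ∧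
          (ThetaSetting.modelχq' p 0 2 even_two).IsTateOrigin)) := by
  refine ⟨⟨ThetaSetting.modelχq p 0 2 even_two, ?_⟩, ⟨ThetaSetting.modelκ' p, ?_⟩,
    no_joint_isThm16Origin_isTateOrigin_in_zoo p 0⟩
  · obtain ⟨h0, hT, hTop, -, -, -, hZ, hs, -, h16⟩ := modelχq_thm16iiiOriginInputs p 0 hsc
    exact ⟨h0, hT, hTop, hZ, hs, h16⟩
  · obtain ⟨h0, h16, hL, -, -, hcusp, hs, -, hT⟩ := modelκ'_thm16iiiOriginInputs p
    exact ⟨h0, h16, hL, hcusp, hs, hT⟩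

end Literature.AnabelianGeometry.EtaleTheta.SettingModel

end
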